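import Summits.QuantumFields.YangMills.Theorems.ScalingWindowSplitSelfNormalisedSkewnessStubTwoPointKernel
import Summits.QuantumFields.YangMills.Theorems.ScalingWindowSplitSelfNormalisedSkewnessStubTorusGreenThirdDiff
import Summits.QuantumFields.YangMills.Theses.ScalingWindowSplit
import HarnessLib

/-!
# Crux `SelfNormalisedSkewness` (stmt-QuantumFields-18944), line `Sketch`, stub `stub_twoPointSmearing`:
# preparations and the upper half

The stub `stub_twoPointSmearing` bounds the smeared tree-level two-point kernel
`TP(u) = ∑_{x ≠ y ∈ box} u(a x) (θu)(a y) ∑_{αα'} π_{αα'}(x - y)²` of a reflected pair of bumps on the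
lattice `a ℤ⁴ ∩ [-aL, aL]⁴`, `a²L = 1`, from above (supports separated from the reflection plane) and
from below (a bump equal to one on a small ball). This file contains

* the no-wrap-around geometry: an integer of modulus `≤ L` is its own centred representative modulo
  `S = 2L + 1` (`tpsNoWrap_valMinAbs_intCast`, `tpsNoWrap_valMinAbs_proj_sub`), so that the landed
  kernel bounds `stub_twoPointKernel` (with `stub_torusGreenThirdDiff`) read directly in terms of the
  integer difference vector (`twoPointKernel_upper_noWrap`, `twoPointKernel_lower_noWrap`);
* elementary counting and metric lemmas on `ℤ⁴ ⊆ ℝ⁴` used by both halves;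
* the upper half `twoPointSmearing_upper`: every contributing pair has time separation `≥ 2ρ₀/a`,
  so the kernel is `≤ C (a/2ρ₀)⁸`, while at most `(2R/a + 1)⁸` pairs contribute and `|u| ≤ ‖u‖_∞`.

Everything is folklore; no named facts are used.
-/

noncomputable section

open scoped BigOperators
open Finset
open Literature.MathematicalPhysics.QuantumLattice (siteToE thetaTest timeReflection siteToE_apply
  thetaTest_apply timeReflection_apply)
open Literature.Probability.LatticeModels

namespace Summit.QuantumFields.YangMills.Theorems.SelfNormalisedSkewness.Negative

/-! ### No wrap-around and small geometric lemmas -/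

/-- No wrap-around: an integer of modulus `≤ L` is its own centred representative modulo `2L + 1`.
[folklore] -/
theorem tpsNoWrap_valMinAbs_intCast {L : ℕ} {m : ℤ} (hm : |m| ≤ (L : ℤ)) :
    ((m : ZMod (2 * L + 1))).valMinAbs = m := by
  rw [ZMod.valMinAbs_spec, Set.mem_Ioc]
  obtain ⟨h1, h2⟩ := abs_le.1 hm
  refine ⟨rfl, ?_, ?_⟩ <;> push_cast <;> omega

/-- Coordinates of a difference of projected lattice points, without wrap-around. [folklore] -/
theorem tpsNoWrap_valMinAbs_proj_sub {L : ℕ} (x y : Site 4) (i : Fin 4) (h : |x i - y i| ≤ (L : ℤ)) :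
    ((Torus.proj (2 * L + 1) x - Torus.proj (2 * L + 1) y) i).valMinAbs = x i - y i := by
  have e : (Torus.proj (2 * L + 1) x - Torus.proj (2 * L + 1) y) i =
      ((x i - y i : ℤ) : ZMod (2 * L + 1)) := by
    simp [Torus.proj_apply, Int.cast_sub]
  rw [e, tpsNoWrap_valMinAbs_intCast h]

/-- A centred coordinate is at most the Euclidean torus distance. [folklore] -/
theorem tps_abs_valMinAbs_le_torusDist {S : ℕ} (z : TorusSite 4 S) (μ₀ : Fin 4) :
    |(((z μ₀).valMinAbs : ℤ) : ℝ)| ≤ Real.sqrt (∑ μ, (((z μ).valMinAbs : ℤ) : ℝ) ^ 2) := by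
  rw [← Real.sqrt_sq_eq_abs]
  exact Real.sqrt_le_sqrt (Finset.single_le_sum (f := fun μ => (((z μ).valMinAbs : ℤ) : ℝ) ^ 2)
    (fun μ _ => sq_nonneg _) (Finset.mem_univ μ₀))

/-- The real interval `[α, β]` contains at least `β - α - 1` integers. [folklore] -/
theorem tps_le_card_Icc_ceil_floor (α β : ℝ) :
    β - α - 1 ≤ (#(Finset.Icc ⌈α⌉ ⌊β⌋) : ℝ) := by
  rw [Int.card_Icc]
  have h1 : (⌈α⌉ : ℝ) < α + 1 := Int.ceil_lt_add_one α
  have h2 : β - 1 < (⌊β⌋ : ℝ) := Int.sub_one_lt_floor β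
  have h3 : ((⌊β⌋ + 1 - ⌈α⌉ : ℤ) : ℝ) ≤ (((⌊β⌋ + 1 - ⌈α⌉).toNat : ℤ) : ℝ) := by
    exact_mod_cast Int.self_le_toNat _
  push_cast at h3
  have h4 : (((⌊β⌋ + 1 - ⌈α⌉).toNat : ℤ) : ℝ) = (((⌊β⌋ + 1 - ⌈α⌉).toNat : ℕ) : ℝ) := by
    norm_cast
  linarith

/-- A product of four finite sets of integers each of size `≥ m` has size `≥ m⁴`. [folklore] -/
theorem tps_pow_four_le_card_piFinset {s : Fin 4 → Finset ℤ} {m : ℝ} (hm : 0 ≤ m)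
    (h : ∀ i, m ≤ (#(s i) : ℝ)) : m ^ 4 ≤ (#(Fintype.piFinset s) : ℝ) := by
  rw [Fintype.card_piFinset, Nat.cast_prod, show m ^ 4 = ∏ _i : Fin 4, m from
    (Fin.prod_const 4 m).symm]
  exact Finset.prod_le_prod (fun _ _ => hm) (fun i _ => h i)

/-- A lattice point with real coordinates of modulus `≤ t` lies in `box 4 ⌊t⌋₊`. [folklore] -/
theorem tps_mem_box_floor_of_abs_le {t : ℝ} (ht : 0 ≤ t) {x : Site 4} (h : ∀ i, |(x i : ℝ)| ≤ t) :
    x ∈ box 4 ⌊t⌋₊ := by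
  rw [mem_box]
  intro i
  obtain ⟨h1, h2⟩ := abs_le.1 (h i)
  rw [Int.natCast_floor_eq_floor ht]
  constructor
  · rw [neg_le, Int.le_floor]; push_cast; linarith
  · rw [Int.le_floor]; exact h2

/-- A real bound `|m| ≤ L` on an integer is an integer bound. [folklore] -/
theorem tps_int_abs_le_natCast {m : ℤ} {L : ℕ} (h : |(m : ℝ)| ≤ (L : ℝ)) : |m| ≤ (L : ℤ) := by
  have h' : ((|m| : ℤ) : ℝ) ≤ ((L : ℤ) : ℝ) := by rwa [Int.cast_abs, Int.cast_natCast]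
  exact_mod_cast h'

/-- A nonnegative double sum over `x ≠ y` in `B` dominates its restriction to the sub-family of pairs
`(x, x - n)`, `x ∈ Xs`, `n ∈ Ns`. [folklore] -/
theorem tps_subfamily_le_sum_erase {F : Site 4 → Site 4 → ℝ} {Xs Ns B : Finset (Site 4)} {κ : ℝ}
    (hF : ∀ x y, 0 ≤ F x y) (hX : Xs ⊆ B)
    (hN : ∀ x ∈ Xs, ∀ n ∈ Ns, x - n ∈ B ∧ x - n ≠ x ∧ κ ≤ F x (x - n)) :
    (#Xs : ℝ) * #Ns * κ ≤ ∑ x ∈ B, ∑ y ∈ B.erase x, F x y := by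
  calc (#Xs : ℝ) * #Ns * κ = ∑ _x ∈ Xs, ∑ _n ∈ Ns, κ := by
        simp only [Finset.sum_const, nsmul_eq_mul]; ring
    _ ≤ ∑ x ∈ Xs, ∑ n ∈ Ns, F x (x - n) :=
        Finset.sum_le_sum fun x hx => Finset.sum_le_sum fun n hn => (hN x hx n hn).2.2
    _ = ∑ x ∈ Xs, ∑ y ∈ Ns.image (fun n => x - n), F x y := by
        refine Finset.sum_congr rfl fun x _ => ?_
        rw [Finset.sum_image]
        intro n _ m _ h
        exact sub_right_injective h
    _ ≤ ∑ x ∈ Xs, ∑ y ∈ B.erase x, F x y := by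
        refine Finset.sum_le_sum fun x hx => ?_
        refine Finset.sum_le_sum_of_subset_of_nonneg ?_ fun y _ _ => hF x y
        intro y hy
        obtain ⟨n, hn, rfl⟩ := Finset.mem_image.1 hy
        exact Finset.mem_erase.2 ⟨(hN x hx n hn).2.1, (hN x hx n hn).1⟩
    _ ≤ ∑ x ∈ B, ∑ y ∈ B.erase x, F x y :=
        Finset.sum_le_sum_of_subset_of_nonneg hX fun x _ _ =>
          Finset.sum_nonneg fun y _ => hF x y

/-! ### The kernel bounds without wrap-around -/

/-- The upper kernel bound of `stub_twoPointKernel` for a pair of lattice points at integer distance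
`≤ L` in every coordinate: `∑ π² ≤ C_K |x₀ - y₀|⁻⁸`. [folklore] -/
theorem twoPointKernel_upper_noWrap : ∃ CK : ℝ, 0 ≤ CK ∧ ∀ (L : ℕ)
    (H : TorusSite 4 (2 * L + 1) → Fin 4 → Fin 4 → ℝ),
    (∀ z i j, H z i j = torusGreen (z + Pi.single i 1) -
      torusGreen (z + Pi.single i 1 - Pi.single j 1) - torusGreen z + torusGreen (z - Pi.single j 1)) →
    ∀ (πK : TorusSite 4 (2 * L + 1) → {q : Fin 4 × Fin 4 // q.1 < q.2} →
      {q : Fin 4 × Fin 4 // q.1 < q.2} → ℝ),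
    (∀ n α α', πK n α α' = (1 / 2 : ℝ) * (-(H n α.1.1 α'.1.1) * (if α.1.2 = α'.1.2 then 1 else 0)
        + H n α.1.1 α'.1.2 * (if α.1.2 = α'.1.1 then 1 else 0)
        + H n α.1.2 α'.1.1 * (if α.1.1 = α'.1.2 then 1 else 0)
        - H n α.1.2 α'.1.2 * (if α.1.1 = α'.1.1 then 1 else 0))) →
    ∀ x y : Site 4, (∀ i, |x i - y i| ≤ (L : ℤ)) → x 0 ≠ y 0 →
      ∑ α, ∑ α', (πK (Torus.proj (2 * L + 1) x - Torus.proj (2 * L + 1) y) α α') ^ 2 ≤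
        CK * |((x 0 - y 0 : ℤ) : ℝ)|⁻¹ ^ 8 := by
  obtain ⟨C, hC⟩ := (stub_twoPointKernel stub_torusGreenThirdDiff).1
  refine ⟨max C 0, le_max_right _ _, fun L H hH πK hπK x y hxy h0 => ?_⟩
  obtain ⟨n, hn⟩ : ∃ n : TorusSite 4 (2 * L + 1),
      n = Torus.proj (2 * L + 1) x - Torus.proj (2 * L + 1) y := ⟨_, rfl⟩
  have hv : ∀ i, (n i).valMinAbs = x i - y i := fun i => by
    rw [hn]; exact tpsNoWrap_valMinAbs_proj_sub x y i (hxy i)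
  have hn0 : n ≠ 0 := by
    intro h
    have := hv 0
    rw [h, Pi.zero_apply, ZMod.valMinAbs_zero] at this
    omega
  have h1 := hC (2 * L + 1) H hH πK hπK n hn0
  rw [← hn]
  have hd : |((x 0 - y 0 : ℤ) : ℝ)| ≤ Real.sqrt (∑ μ, (((n μ).valMinAbs : ℤ) : ℝ) ^ 2) := by
    rw [← hv 0]; exact tps_abs_valMinAbs_le_torusDist n 0
  have hpos : 0 < |((x 0 - y 0 : ℤ) : ℝ)| := abs_pos.2 (by exact_mod_cast sub_ne_zero.2 h0)
  calc _ ≤ C * (Real.sqrt (∑ μ, (((n μ).valMinAbs : ℤ) : ℝ) ^ 2))⁻¹ ^ 8 := h1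
    _ ≤ max C 0 * (Real.sqrt (∑ μ, (((n μ).valMinAbs : ℤ) : ℝ) ^ 2))⁻¹ ^ 8 :=
        mul_le_mul_of_nonneg_right (le_max_left _ _) (by positivity)
    _ ≤ max C 0 * |((x 0 - y 0 : ℤ) : ℝ)|⁻¹ ^ 8 :=
        mul_le_mul_of_nonneg_left (pow_le_pow_left₀ (by positivity) (inv_anti₀ hpos hd) 8)
          (le_max_right _ _)

/-- The lower kernel bound of `stub_twoPointKernel` on the cone, for the pair `(x, x - n)` with
`|nᵢ| ≤ L`: `c₀ |n₀|⁻⁸ ≤ ∑ π²`. [folklore] -/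
theorem twoPointKernel_lower_noWrap : ∃ c₀ δ₀ : ℝ, 0 < c₀ ∧ 0 < δ₀ ∧ ∀ (L : ℕ)
    (H : TorusSite 4 (2 * L + 1) → Fin 4 → Fin 4 → ℝ),
    (∀ z i j, H z i j = torusGreen (z + Pi.single i 1) -
      torusGreen (z + Pi.single i 1 - Pi.single j 1) - torusGreen z + torusGreen (z - Pi.single j 1)) →
    ∀ (πK : TorusSite 4 (2 * L + 1) → {q : Fin 4 × Fin 4 // q.1 < q.2} →
      {q : Fin 4 × Fin 4 // q.1 < q.2} → ℝ),
    (∀ n α α', πK n α α' = (1 / 2 : ℝ) * (-(H n α.1.1 α'.1.1) * (if α.1.2 = α'.1.2 then 1 else 0)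
        + H n α.1.1 α'.1.2 * (if α.1.2 = α'.1.1 then 1 else 0)
        + H n α.1.2 α'.1.1 * (if α.1.1 = α'.1.2 then 1 else 0)
        - H n α.1.2 α'.1.2 * (if α.1.1 = α'.1.1 then 1 else 0))) →
    ∀ x n : Site 4, (∀ i, |n i| ≤ (L : ℤ)) → n 0 ≠ 0 →
      16 * |(n 0 : ℝ)| ≤ ((2 * L + 1 : ℕ) : ℝ) → |(n 0 : ℝ)| ^ 5 ≤ ((2 * L + 1 : ℕ) : ℝ) ^ 4 →
      (∀ i, i ≠ 0 → |(n i : ℝ)| ≤ δ₀ * |(n 0 : ℝ)|) →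
      c₀ * |(n 0 : ℝ)|⁻¹ ^ 8 ≤
        ∑ α, ∑ α', (πK (Torus.proj (2 * L + 1) x - Torus.proj (2 * L + 1) (x - n)) α α') ^ 2 := by
  obtain ⟨c₀, δ₀, hc₀, hδ₀, h⟩ := (stub_twoPointKernel stub_torusGreenThirdDiff).2
  refine ⟨c₀, δ₀, hc₀, hδ₀, fun L H hH πK hπK x n hw hn0 h16 h5 hcone => ?_⟩
  obtain ⟨m, hm⟩ : ∃ m : TorusSite 4 (2 * L + 1),
      m = Torus.proj (2 * L + 1) x - Torus.proj (2 * L + 1) (x - n) := ⟨_, rfl⟩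
  have e : ∀ i, x i - (x - n) i = n i := fun i => by simp
  have hv : ∀ i, (m i).valMinAbs = n i := fun i => by
    rw [hm, ← e i]; exact tpsNoWrap_valMinAbs_proj_sub x (x - n) i (by rw [e i]; exact hw i)
  have hm0 : m 0 ≠ 0 := by
    intro h0
    have := hv 0
    rw [h0, ZMod.valMinAbs_zero] at this
    exact hn0 this.symm
  have key := h (2 * L + 1) H hH πK hπK m hm0
  rw [hv 0] at key
  rw [← hm]
  exact key h16 h5 fun i hi => by rw [hv i]; exact hcone i hi

/-! ### The upper half: core estimate -/

/-- **Upper half, core estimate.** For `u` supported in `{y₀ ≤ -ρ₀} ∩ B(0, R)` with `|u| ≤ M`, a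
nonnegative kernel `K(x, y) ≤ C_K |x₀ - y₀|⁻⁸` (no wrap-around, `x₀ ≠ y₀`) and `a² L = 1`,
`2aR ≤ 1`, `a ≤ 1`: the smeared sum is `≤ M² C_K ((2R + 1)/(2ρ₀))⁸` — contributing pairs have
`|xᵢ|, |yᵢ| ≤ R/a` and `y₀ - x₀ ≥ 2ρ₀/a`. [folklore] -/
theorem twoPointSmearing_upper_core {u : SchwartzMap (EuclideanSpace ℝ (Fin 4)) ℝ} {R ρ₀ M CK a : ℝ} {L : ℕ}
    (hρ₀ : 0 < ρ₀) (hR : 0 ≤ R)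
    (hsupp₁ : tsupport u ⊆ {y : EuclideanSpace ℝ (Fin 4) | y 0 ≤ -ρ₀})
    (hsupp₂ : tsupport u ⊆ Metric.closedBall (0 : EuclideanSpace ℝ (Fin 4)) R)
    (hM : ∀ v, |u v| ≤ M) (hCK : 0 ≤ CK)
    (ha : 0 < a) (ha1 : a ≤ 1) (haR : 2 * a * R ≤ 1) (hL : a ^ 2 * (L : ℝ) = 1)
    (K : Site 4 → Site 4 → ℝ) (hK0 : ∀ x y, 0 ≤ K x y)
    (hK : ∀ x y, (∀ i, |x i - y i| ≤ (L : ℤ)) → x 0 ≠ y 0 →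
      K x y ≤ CK * |((x 0 - y 0 : ℤ) : ℝ)|⁻¹ ^ 8) :
    ∑ x ∈ box 4 L, ∑ y ∈ (box 4 L).erase x,
        u (a • siteToE x) * thetaTest 4 u (a • siteToE y) * K x y ≤
      M ^ 2 * CK * ((2 * R + 1) / (2 * ρ₀)) ^ 8 := by
  -- the scale `ℓ = a L = 1 / a`
  obtain ⟨ℓ, hℓdef⟩ : ∃ ℓ : ℝ, ℓ = a * L := ⟨_, rfl⟩
  have hℓ : a * ℓ = 1 := by rw [hℓdef, ← mul_assoc, ← sq, hL]
  have hℓpos : 0 < ℓ := pos_of_mul_pos_right (by rw [hℓ]; exact one_pos) ha.le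
  have hLℓ : (L : ℝ) = ℓ * ℓ := by
    calc (L : ℝ) = (a * ℓ) * L := by rw [hℓ, one_mul]
      _ = ℓ * ℓ := by rw [hℓdef]; ring
  have hM0 : 0 ≤ M := (abs_nonneg _).trans (hM 0)
  have h2R : 2 * R ≤ ℓ := by
    calc 2 * R = ℓ * (2 * a * R) := by linear_combination (-2 * R) * hℓ
      _ ≤ ℓ * 1 := mul_le_mul_of_nonneg_left haR hℓpos.le
      _ = ℓ := mul_one ℓ
  have scale : ∀ (m t : ℝ), |a * m| ≤ t → |m| ≤ t * ℓ := fun m t h => by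
    have e : |m| = ℓ * |a * m| := by
      rw [abs_mul, abs_of_pos ha, ← mul_assoc, mul_comm ℓ a, hℓ, one_mul]
    rw [e, mul_comm t ℓ]
    exact mul_le_mul_of_nonneg_left h hℓpos.le
  -- the counting box and the per-term bound
  obtain ⟨P, hP⟩ : ∃ P : Finset (Site 4), P = box 4 ⌊R * ℓ⌋₊ := ⟨_, rfl⟩
  obtain ⟨B, hB⟩ : ∃ B : ℝ, B = M ^ 2 * (CK * (2 * ρ₀ * ℓ)⁻¹ ^ 8) := ⟨_, rfl⟩
  have hB0 : 0 ≤ B := by rw [hB]; positivity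
  obtain ⟨ind, hind⟩ : ∃ ind : Site 4 → ℝ, ind = fun x => if x ∈ P then 1 else 0 := ⟨_, rfl⟩
  have hind0 : ∀ x, 0 ≤ ind x := fun x => by
    simp only [hind]
    split_ifs <;> norm_num
  have hind1 : ∀ x, x ∈ P → ind x = 1 := fun x hx => by
    simp only [hind]
    exact if_pos hx
  have hPcard : (#P : ℝ) ≤ (2 * (R * ℓ) + 1) ^ 4 := by
    rw [hP, card_box]
    push_cast
    exact pow_le_pow_left₀ (by positivity)
      (by linarith [Nat.floor_le (by positivity : 0 ≤ R * ℓ)]) 4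
  have hterm : ∀ x y : Site 4,
      u (a • siteToE x) * thetaTest 4 u (a • siteToE y) * K x y ≤ ind x * ind y * B := by
    intro x y
    have hrhs : 0 ≤ ind x * ind y * B := mul_nonneg (mul_nonneg (hind0 x) (hind0 y)) hB0
    by_cases hux : u (a • siteToE x) = 0
    · rw [hux, zero_mul, zero_mul]; exact hrhs
    by_cases huy : thetaTest 4 u (a • siteToE y) = 0
    · rw [huy, mul_zero, zero_mul]; exact hrhs
    have hxs : a • siteToE x ∈ tsupport u := subset_tsupport _ (Function.mem_support.2 hux)
    have hys : timeReflection 4 (a • siteToE y) ∈ tsupport u := by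
      refine subset_tsupport _ (Function.mem_support.2 ?_)
      rwa [thetaTest_apply] at huy
    have cx : ∀ i, (a • siteToE x) i = a * x i := fun i => by simp
    have cy : ∀ i, (timeReflection 4 (a • siteToE y)) i = if i = 0 then -(a * y i) else a * y i :=
      fun i => by simp [timeReflection_apply]
    have hxR : ∀ i, |a * (x i : ℝ)| ≤ R := fun i => by
      have h := hsupp₂ hxs
      rw [Metric.mem_closedBall, dist_zero_right] at h
      have h' := PiLp.norm_apply_le (a • siteToE x) i
      rw [cx, Real.norm_eq_abs] at h'
      exact h'.trans h
    have hyR : ∀ i, |a * (y i : ℝ)| ≤ R := fun i => by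
      have h := hsupp₂ hys
      rw [Metric.mem_closedBall, dist_zero_right] at h
      have h' := PiLp.norm_apply_le (timeReflection 4 (a • siteToE y)) i
      rw [cy, Real.norm_eq_abs] at h'
      split_ifs at h' with hi
      · rw [abs_neg] at h'; exact h'.trans h
      · exact h'.trans h
    have hx0 : a * (x 0 : ℝ) ≤ -ρ₀ := by
      have h := hsupp₁ hxs
      rw [Set.mem_setOf_eq, cx] at h
      exact h
    have hy0 : ρ₀ ≤ a * (y 0 : ℝ) := by
      have h := hsupp₁ hys
      rw [Set.mem_setOf_eq, cy, if_pos rfl] at h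
      linarith
    have hxP : x ∈ P := hP ▸ tps_mem_box_floor_of_abs_le (by positivity) fun i => scale _ _ (hxR i)
    have hyP : y ∈ P := hP ▸ tps_mem_box_floor_of_abs_le (by positivity) fun i => scale _ _ (hyR i)
    have hwrap : ∀ i, |x i - y i| ≤ (L : ℤ) := fun i => by
      apply tps_int_abs_le_natCast
      have h1 := scale _ _ (hxR i)
      have h2 := scale _ _ (hyR i)
      push_cast
      calc |(x i : ℝ) - y i| ≤ |(x i : ℝ)| + |(y i : ℝ)| := abs_sub _ _
        _ ≤ R * ℓ + R * ℓ := add_le_add h1 h2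
        _ = (2 * R) * ℓ := by ring
        _ ≤ ℓ * ℓ := mul_le_mul_of_nonneg_right h2R hℓpos.le
        _ = L := hLℓ.symm
    have hne : x 0 ≠ y 0 := by
      have h : (x 0 : ℝ) < y 0 := lt_of_mul_lt_mul_left (by linarith) ha.le
      exact ne_of_lt (by exact_mod_cast h)
    have hd : 2 * ρ₀ * ℓ ≤ |((x 0 - y 0 : ℤ) : ℝ)| := by
      push_cast
      refine le_abs.2 (Or.inr ?_)
      calc 2 * ρ₀ * ℓ = ℓ * (2 * ρ₀) := by ring
        _ ≤ ℓ * (a * ((y 0 : ℝ) - x 0)) := mul_le_mul_of_nonneg_left (by linarith) hℓpos.le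
        _ = -((x 0 : ℝ) - y 0) := by linear_combination ((y 0 : ℝ) - x 0) * hℓ
    have hKxy : K x y ≤ CK * (2 * ρ₀ * ℓ)⁻¹ ^ 8 :=
      (hK x y hwrap hne).trans (mul_le_mul_of_nonneg_left
        (pow_le_pow_left₀ (inv_nonneg.2 (abs_nonneg _)) (inv_anti₀ (by positivity) hd) 8) hCK)
    have hθ : |thetaTest 4 u (a • siteToE y)| ≤ M := hM _
    calc u (a • siteToE x) * thetaTest 4 u (a • siteToE y) * K x y
        ≤ |u (a • siteToE x)| * |thetaTest 4 u (a • siteToE y)| * K x y := by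
          refine mul_le_mul_of_nonneg_right ?_ (hK0 x y)
          rw [← abs_mul]; exact le_abs_self _
      _ ≤ M * M * (CK * (2 * ρ₀ * ℓ)⁻¹ ^ 8) :=
          mul_le_mul (mul_le_mul (hM _) hθ (abs_nonneg _) hM0) hKxy (hK0 x y) (by positivity)
      _ = ind x * ind y * B := by
          rw [hind1 x hxP, hind1 y hyP, hB]; ring
  -- summation
  have hS : (∑ x ∈ box 4 L, ind x) ≤ #P := by
    simp only [hind, Finset.sum_boole]
    exact_mod_cast Finset.card_le_card fun x hx => (Finset.mem_filter.1 hx).2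
  have hS0 : 0 ≤ ∑ x ∈ box 4 L, ind x := Finset.sum_nonneg fun x _ => hind0 x
  have hid : (2 * (R * ℓ) + 1) * (2 * ρ₀ * ℓ)⁻¹ = (2 * R + a) / (2 * ρ₀) := by
    rw [← div_eq_mul_inv, div_eq_div_iff (by positivity) (by positivity)]
    linear_combination (-2 * ρ₀) * hℓ
  calc ∑ x ∈ box 4 L, ∑ y ∈ (box 4 L).erase x,
        u (a • siteToE x) * thetaTest 4 u (a • siteToE y) * K x y
      ≤ ∑ x ∈ box 4 L, ∑ y ∈ (box 4 L).erase x, ind x * ind y * B :=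
        Finset.sum_le_sum fun x _ => Finset.sum_le_sum fun y _ => hterm x y
    _ ≤ ∑ x ∈ box 4 L, ∑ y ∈ box 4 L, ind x * ind y * B :=
        Finset.sum_le_sum fun x _ => Finset.sum_le_sum_of_subset_of_nonneg
          (Finset.erase_subset _ _) fun y _ _ => mul_nonneg (mul_nonneg (hind0 x) (hind0 y)) hB0
    _ = (∑ x ∈ box 4 L, ind x) * (∑ y ∈ box 4 L, ind y) * B := by
        rw [Finset.sum_mul_sum, Finset.sum_mul]
        simp_rw [Finset.sum_mul]
    _ ≤ (#P : ℝ) * #P * B :=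
        mul_le_mul_of_nonneg_right (mul_le_mul hS hS hS0 (Nat.cast_nonneg _)) hB0
    _ ≤ (2 * (R * ℓ) + 1) ^ 4 * (2 * (R * ℓ) + 1) ^ 4 * B :=
        mul_le_mul_of_nonneg_right (mul_le_mul hPcard hPcard (Nat.cast_nonneg _) (by positivity))
          hB0
    _ = M ^ 2 * CK * ((2 * (R * ℓ) + 1) * (2 * ρ₀ * ℓ)⁻¹) ^ 8 := by rw [hB]; ring
    _ = M ^ 2 * CK * ((2 * R + a) / (2 * ρ₀)) ^ 8 := by rw [hid]
    _ ≤ M ^ 2 * CK * ((2 * R + 1) / (2 * ρ₀)) ^ 8 :=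
        mul_le_mul_of_nonneg_left (pow_le_pow_left₀ (by positivity)
          (div_le_div_of_nonneg_right (by linarith) (by positivity)) 8) (by positivity)

/-! ### The upper half -/

/-- **Upper half of `stub_twoPointSmearing`** (main theorem of this file): for `u` supported in
`{y₀ ≤ -ρ₀} ∩ B(0, R)` the smeared tree-level two-point kernel of the reflected pair `(u, θu)` is
bounded uniformly in the lattice spacing `a ≤ 1` with `2aR ≤ 1`, `a²L = 1`. [folklore] -/
theorem twoPointSmearing_upper :
    ∀ (u : SchwartzMap (EuclideanSpace ℝ (Fin 4)) ℝ) (R ρ₀ : ℝ), 0 < ρ₀ →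
      tsupport u ⊆ {y : EuclideanSpace ℝ (Fin 4) | y 0 ≤ -ρ₀} →
      tsupport u ⊆ Metric.closedBall (0 : EuclideanSpace ℝ (Fin 4)) R →
      ∃ C : ℝ, ∀ (a : ℝ), 0 < a → a ≤ 1 → 2 * a * R ≤ 1 → ∀ (L : ℕ), a ^ 2 * (L : ℝ) = 1 →
      ∀ (H : TorusSite 4 (2 * L + 1) → Fin 4 → Fin 4 → ℝ),
      (∀ z i j, H z i j = torusGreen (z + Pi.single i 1) - torusGreen (z + Pi.single i 1 - Pi.single j 1) -
        torusGreen z + torusGreen (z - Pi.single j 1)) →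
      ∀ (πK : TorusSite 4 (2 * L + 1) → {q : Fin 4 × Fin 4 // q.1 < q.2} → {q : Fin 4 × Fin 4 // q.1 < q.2} → ℝ),
      (∀ n α α', πK n α α' = (1 / 2 : ℝ) * (-(H n α.1.1 α'.1.1) * (if α.1.2 = α'.1.2 then 1 else 0)
          + H n α.1.1 α'.1.2 * (if α.1.2 = α'.1.1 then 1 else 0)
          + H n α.1.2 α'.1.1 * (if α.1.1 = α'.1.2 then 1 else 0)
          - H n α.1.2 α'.1.2 * (if α.1.1 = α'.1.1 then 1 else 0))) →
      ∑ x ∈ box 4 L, ∑ y ∈ (box 4 L).erase x,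
          u (a • siteToE x) * thetaTest 4 u (a • siteToE y) *
            ∑ α, ∑ α', (πK (Torus.proj (2 * L + 1) x - Torus.proj (2 * L + 1) y) α α') ^ 2 ≤ C := by
  intro u R ρ₀ hρ₀ h1 h2
  obtain ⟨CK, hCK0, hK⟩ := twoPointKernel_upper_noWrap
  refine ⟨(SchwartzMap.seminorm ℝ 0 0 u) ^ 2 * CK * ((2 * max R 0 + 1) / (2 * ρ₀)) ^ 8, ?_⟩
  intro a ha ha1 haR L hL H hH πK hπK
  have h2' : tsupport u ⊆ Metric.closedBall (0 : EuclideanSpace ℝ (Fin 4)) (max R 0) :=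
    h2.trans (Metric.closedBall_subset_closedBall (le_max_left _ _))
  have haR' : 2 * a * max R 0 ≤ 1 := by
    rw [mul_max_of_nonneg _ _ (by positivity : (0 : ℝ) ≤ 2 * a), mul_zero]
    exact max_le haR zero_le_one
  exact twoPointSmearing_upper_core hρ₀ (le_max_right R 0) h1 h2'
    (fun v => by have h := SchwartzMap.norm_le_seminorm ℝ u v; rwa [Real.norm_eq_abs] at h)
    hCK0 ha ha1 haR' hL
    (fun x y => ∑ α, ∑ α', (πK (Torus.proj (2 * L + 1) x - Torus.proj (2 * L + 1) y) α α') ^ 2)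
    (fun x y => Finset.sum_nonneg fun _ _ => Finset.sum_nonneg fun _ _ => sq_nonneg _)
    (fun x y hw hne => hK L H hH πK hπK x y hw hne)

end Summit.QuantumFields.YangMills.Theorems.SelfNormalisedSkewness.Negative

end
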